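import Mathlib
import Literature.Analysis.SpecialFunctions.SemigroupPosDef
import Literature.MeasureTheory.Integral.WidderLaplaceRepresentation
import HarnessLib

/-!
# Positive-definite functions on `((0,∞),+)` bounded near infinity are automatically continuous

A function `f : ℝ → ℝ` positive definite on the additive semigroup `(0,∞)` (`∑ cᵢcⱼ f(sᵢ+sⱼ) ≥ 0`) and bounded
above on every `[t₀,∞)` is non-increasing and midpoint convex on `(0,∞)` (the orders `1` and `2` of the tree's
`SemigroupPosDef.iter_fwdDiff_nonneg`); hence the increments `d(u) = f(x-u) - f(x)` satisfy `d(u) ≤ d(2u)/2` and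
`0 ≤ f(x) - f(x+u) ≤ d(u)`, so `f` is CONTINUOUS on `(0,∞)` (`SemigroupPosDef.continuousOn`) — Widder's remark that
exponentially convex functions bounded in a neighbourhood of each point are continuous [cite: Widder1941, Ch. VI §19–§21;
Ch. IV §2 (completely monotonic functions in the difference sense are continuous)], [cite: BergChristensenRessel1984,
Ch. 4 §4.4 and Thm. 6.13].  Consequently Widder's theorem in measure form needs no continuity hypothesis:
`exists_measure_laplace_eq_of_semigroupPosDef'`.

THEOREMS ONLY; Mathlib + tree; no `sorry`; standard axioms.  Motivation in the tree: the Bochner slices `t ↦ m_t(B)` of a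
reflection-positive kernel are positive definite and bounded but not a priori continuous (crux ⟨stmt-QuantumFields-23125⟩,
LINE g18-A stub `stub_laplaceFourier`).
-/

noncomputable section

open Set Filter Topology
open scoped fwdDiff

namespace Literature.Analysis.SpecialFunctions

namespace SemigroupPosDef

variable {f : ℝ → ℝ}

/-- **Midpoint convexity** of a positive-definite function on `(0,∞)` bounded on every `[t₀,∞)`:
`2 f(t + u) ≤ f t + f (t + 2u)` for `t > 0`, `u ≥ 0` (order `2` of `iter_fwdDiff_nonneg`).
[cite: Widder1941, Ch. IV §2] -/
theorem two_mul_le_add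
    (h : ∀ (m : ℕ) (s c : Fin m → ℝ), (∀ k₀, 0 < s k₀) → 0 ≤ ∑ i₁, ∑ i₂, c i₁ * c i₂ * f (s i₁ + s i₂))
    (hb : ∀ t₀ : ℝ, 0 < t₀ → ∃ M : ℝ, ∀ τ : ℝ, t₀ ≤ τ → f τ ≤ M)
    {t u : ℝ} (ht : 0 < t) (hu : 0 ≤ u) : 2 * f (t + u) ≤ f t + f (t + 2 * u) := by
  have h2 := iter_fwdDiff_nonneg h hb hu 2 ht
  simp only [Function.iterate_succ, Function.iterate_zero, Function.comp_apply, id_eq, fwdDiff] at h2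
  have e : t + u + u = t + 2 * u := by ring
  rw [e] at h2
  nlinarith [h2]

/-- **Automatic continuity**: a function positive definite on `((0,∞),+)` and bounded above on every `[t₀,∞)` is
continuous on `(0,∞)`. [cite: Widder1941, Ch. VI Thm. 21] [cite: BergChristensenRessel1984, Ch. 4 Thm. 6.13] -/
theorem continuousOn
    (h : ∀ (m : ℕ) (s c : Fin m → ℝ), (∀ k₀, 0 < s k₀) → 0 ≤ ∑ i₁, ∑ i₂, c i₁ * c i₂ * f (s i₁ + s i₂))
    (hb : ∀ t₀ : ℝ, 0 < t₀ → ∃ M : ℝ, ∀ τ : ℝ, t₀ ≤ τ → f τ ≤ M) :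
    ContinuousOn f (Ioi 0) := by
  have hanti := antitoneOn h hb
  intro x hx
  have hx0 : 0 < x := hx
  -- the left increments `d u = f (x - u) - f x`, `0 ≤ u ≤ x/2`
  set d : ℝ → ℝ := fun u => f (x - u) - f x with hd
  have hd_nonneg : ∀ u, 0 ≤ u → u < x → 0 ≤ d u := by
    intro u hu hux
    have := hanti (show x - u ∈ Ioi (0:ℝ) by simp only [mem_Ioi]; linarith) hx (by linarith)
    simp only [hd]; linarith
  have hd_mono : ∀ u v, 0 ≤ u → u ≤ v → v < x → d u ≤ d v := by
    intro u v hu huv hvx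
    have := hanti (show x - v ∈ Ioi (0:ℝ) by simp only [mem_Ioi]; linarith)
      (show x - u ∈ Ioi (0:ℝ) by simp only [mem_Ioi]; linarith) (by linarith)
    simp only [hd]; linarith
  -- the doubling inequality `2 d(u) ≤ d(2u)` from midpoint convexity at `x - 2u`
  have hd_double : ∀ u, 0 ≤ u → 2 * u < x → 2 * d u ≤ d (2 * u) := by
    intro u hu hux
    have := two_mul_le_add h hb (t := x - 2 * u) (u := u) (by linarith) hu
    have e1 : x - 2 * u + u = x - u := by ring
    have e2 : x - 2 * u + 2 * u = x := by ring
    rw [e1, e2] at this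
    simp only [hd]; linarith
  -- hence `d (u₀ / 2^k) ≤ d u₀ / 2^k` for `u₀ = x/4`
  set u₀ : ℝ := x / 4 with hu₀
  have hu₀pos : 0 < u₀ := by positivity
  have hgeom : ∀ k : ℕ, d (u₀ / 2 ^ k) ≤ d u₀ / 2 ^ k := by
    intro k
    induction k with
    | zero => simp
    | succ k ih =>
      have hpow : (0 : ℝ) < 2 ^ k := by positivity
      have h1 := hd_double (u₀ / 2 ^ (k + 1)) (by positivity) (by
        rw [pow_succ]
        have : 2 * (u₀ / (2 ^ k * 2)) = u₀ / 2 ^ k := by field_simp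
        rw [this]
        calc u₀ / 2 ^ k ≤ u₀ / 1 := div_le_div_of_nonneg_left hu₀pos.le one_pos (one_le_pow₀ (by norm_num))
          _ < x := by rw [div_one, hu₀]; linarith)
      have e : 2 * (u₀ / 2 ^ (k + 1)) = u₀ / 2 ^ k := by rw [pow_succ]; field_simp
      rw [e] at h1
      have e' : d u₀ / 2 ^ (k + 1) = d u₀ / 2 ^ k / 2 := by rw [pow_succ, div_div]
      rw [e']
      linarith [h1, ih]
  -- the right increments are dominated by the left ones: `0 ≤ f x - f (x + u) ≤ d u`
  have hright : ∀ u, 0 ≤ u → u < x → 0 ≤ f x - f (x + u) ∧ f x - f (x + u) ≤ d u := by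
    intro u hu hux
    constructor
    · have := hanti hx (show x + u ∈ Ioi (0:ℝ) by simp only [mem_Ioi]; linarith) (by linarith)
      linarith
    · have := two_mul_le_add h hb (t := x - u) (u := u) (by linarith) hu
      have e1 : x - u + u = x := by ring
      have e2 : x - u + 2 * u = x + u := by ring
      rw [e1, e2] at this
      simp only [hd]; linarith
  -- ε-δ
  rw [ContinuousWithinAt, Metric.tendsto_nhdsWithin_nhds]
  intro ε hε
  obtain ⟨k, hk⟩ : ∃ k : ℕ, d u₀ / 2 ^ k < ε := by
    have h0 : 0 ≤ d u₀ := hd_nonneg u₀ hu₀pos.le (by rw [hu₀]; linarith)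
    have hD : 0 < d u₀ + 1 := by linarith
    obtain ⟨k, hk⟩ := exists_pow_lt_of_lt_one (div_pos hε hD) (by norm_num : (1 / 2 : ℝ) < 1)
    refine ⟨k, ?_⟩
    calc d u₀ / 2 ^ k = d u₀ * (1 / 2) ^ k := by rw [one_div_pow, ← div_eq_mul_one_div]
      _ ≤ (d u₀ + 1) * (1 / 2) ^ k := by gcongr; linarith
      _ < (d u₀ + 1) * (ε / (d u₀ + 1)) := mul_lt_mul_of_pos_left hk hD
      _ = ε := by field_simp
  set δ : ℝ := u₀ / 2 ^ k with hδ
  have hδpos : 0 < δ := by positivity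
  have hδx : δ < x := by
    calc δ ≤ u₀ / 1 := div_le_div_of_nonneg_left hu₀pos.le one_pos (one_le_pow₀ (by norm_num))
      _ < x := by rw [div_one, hu₀]; linarith
  refine ⟨δ, hδpos, fun y hy hyx => ?_⟩
  have hy0 : 0 < y := hy
  rw [Real.dist_eq] at hyx ⊢
  have hdδ : d δ < ε := (hgeom k).trans_lt hk
  rcases le_or_gt y x with hyl | hyg
  · -- `y ≤ x`: `0 ≤ f y - f x = d (x - y) ≤ d δ`
    have hu : 0 ≤ x - y := by linarith
    have h1 : f y - f x = d (x - y) := by simp only [hd]; ring_nf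
    have h2 : d (x - y) ≤ d δ := hd_mono _ _ hu (by rw [abs_sub_comm, abs_of_nonneg hu] at hyx; exact hyx.le) hδx
    have h3 : 0 ≤ d (x - y) := hd_nonneg _ hu (by linarith)
    rw [abs_lt]; constructor <;> linarith
  · -- `x < y`: `0 ≤ f x - f y ≤ d (y - x) ≤ d δ`
    have hu : 0 ≤ y - x := by linarith
    have hux : y - x < x := by
      rw [abs_of_pos (by linarith : 0 < y - x)] at hyx; linarith
    obtain ⟨h1, h2⟩ := hright (y - x) hu hux
    have e : x + (y - x) = y := by ring
    rw [e] at h1 h2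
    have h3 : d (y - x) ≤ d δ := hd_mono _ _ hu (by rw [abs_of_nonneg hu] at hyx; exact hyx.le) hδx
    rw [abs_lt]; constructor <;> linarith

end SemigroupPosDef

end Literature.Analysis.SpecialFunctions

namespace Literature.MeasureTheory.Integral

open _root_.MeasureTheory Literature.Analysis.SpecialFunctions

/-- **Widder's theorem, measure form, without continuity hypothesis**: a function positive definite on `((0,∞),+)`
and bounded above on every `[t₀,∞)` is the Laplace transform of one positive measure on `[0,∞)` (continuity is
automatic, `SemigroupPosDef.continuousOn`). [cite: Widder1941, Ch. VI Thm. 21] [cite: BergChristensenRessel1984, Ch. 4 Thm. 6.13] -/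
theorem exists_measure_laplace_eq_of_semigroupPosDef' (f : ℝ → ℝ)
    (h : ∀ (m : ℕ) (s c : Fin m → ℝ), (∀ k₀, 0 < s k₀) → 0 ≤ ∑ i₁, ∑ i₂, c i₁ * c i₂ * f (s i₁ + s i₂))
    (hb : ∀ t₀ : ℝ, 0 < t₀ → ∃ M : ℝ, ∀ τ : ℝ, t₀ ≤ τ → f τ ≤ M) :
    ∃ μ : Measure ℝ, μ (Set.Iio 0) = 0 ∧ ∀ t : ℝ, 0 < t →
      Integrable (fun s => Real.exp (-(t * s))) μ ∧ f t = ∫ s, Real.exp (-(t * s)) ∂μ :=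
  exists_measure_laplace_eq_of_semigroupPosDef f (SemigroupPosDef.continuousOn h hb) h hb

end Literature.MeasureTheory.Integral

end
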